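import Mathlib
import Literature.Topology.KuratowskiUlam

/-!
# Cheng–Xue 2023, Lemma LmResidualKU (arXiv v5 l.1388–1401) and the sentence l.1978: what the Kuratowski–Ulam
# step yields for the fibrewise format, by target format (kernel-checked census)

CITATION HEADER (lean-in-tree rule 2026-08-18). Source under adjudication: C.-Q. Cheng, J. Xue, *Arnold diffusion
for nearly integrable Hamiltonian systems*, Sci. China Math. **66** (2023) no. 8, 1649–1712,
doi:10.1007/s11425-022-2118-1 (bib key `ChengXue2023`), read in the last arXiv text arXiv:1503.04153v5
(`n-diffusion05082019.tex`, locators `l.NNNN`): l.1387 (the dependence note after Prop. `PropGenericity2`),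
l.1388–1401 (Lemma `LmResidualKU` with its proof), l.1402–1404 (Theorem `ThmKU`), l.1978 (the sentence after
Prop. `ProNDGInduction`), l.2140 and l.2183 (downstream use).  The printed pages are not held by the cell
(acq-07843); the print is a REVISION of v5 (cell DIVERGENCE D31/D32), so the printed form of these lines is
unverified.  THIS IS A CLAIMED RESULT UNDER ADJUDICATION by the pub-arnold near-miss cell: nothing in this file
asserts or uses any statement of that paper as a fact.  What is reproduced is ONLY THE FORMAT of the set the lemma
speaks about (`fibreUnion`, an abstraction recorded in the cell's DIVERGENCE.md, L19), and what is PROVED is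
point-set topology about that format, using Oxtoby's Thm 15.4 from `Literature/Topology/KuratowskiUlam.lean`
(J. C. Oxtoby, *Measure and Category*, 2nd ed., GTM 2, Springer 1980, Ch. 15; bib key `Oxtoby1980`).  Cell
records: LEMMAS §3.X AF1‴, claim row C37, GAPS 2026-08-18 (typer g7); it complements `GenericityAssembly.lean`
(AF1″, the KU step of l.2187).

THE TEXT (v5, verbatim where quoted; `Π_{k′}P` is the Fourier projection of the perturbation `P` on the modes
parallel to `k′`).  l.1387: "In the proposition, each 𝒪_{1,2} depends on Π_{k′}P ∈ 𝒪₁, so we denote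
𝒪_{1,2} = 𝒪_{1,2}(Π_{k′}P)."  **Lemma [LmResidualKU]** (l.1388): "The union
⋃_{Π_{k′}P ∈ 𝒪₁} (𝒪_{1,2}(Π_{k′}P) × (C^r(T*𝕋ⁿ)/Π_{k′,k″}C^r(T*𝕋ⁿ))) intersects the unit ball of C^r(T*𝕋ⁿ) in
an open-dense subset of the latter."  Proof (l.1390–1398): "Applying the following Karatowski-Ulam Theorem
[ThmKU], we get that the union ⋃_{Π_{k′}P ∈ 𝒪₁} 𝒪_{1,2}(Π_{k′}P) is a set of second category in C^r(T*𝕋ⁿ).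
Indeed, we first divide 𝒪₁ = 𝒪₁(k′) into union of the form 𝒪₁ = ⋃_{k″} 𝒪_{1,k″} such that each
Π_{k′}P ∈ 𝒪_{1,k″} admits the frequency segment ω̄_a having a second resonance k″ (… note that Π_{k′}P determines
δ hence μ). Each 𝒪_{1,k″} is open (may be empty). … Now each Π_{k′}P ∈ 𝒪_{1,k″} determines an open-dense subset
𝒪_{1,2}(Π_{k′}P) in 𝔅₁(Π_{k′,k″}C^r(T*𝕋ⁿ)/Π_{k′}C^r(T*𝕋ⁿ)) by Proposition [PropGenericity2]. So by the following
Karatowski-Ulam Theorem [ThmKU], the union ⋃_{Π_{k′}P ∈ 𝒪_{1,k″}} 𝒪_{1,2}(Π_{k′}P) is second category in the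
product space 𝒪_{1,k″} × 𝔅₁(Π_{k′,k″}C^r(T*𝕋ⁿ)/Π_{k′}C^r(T*𝕋ⁿ)). Next since each 𝒪_{1,2}(Π_{k′}P) is open in
Π_{k′,k″}C^r(T*𝕋ⁿ)/Π_{k′}C^r(T*𝕋ⁿ), we get that the union ⋃_{Π_{k′}P ∈ 𝒪_{1,k″}} 𝒪_{1,2}(Π_{k′}P) is also open
in Π_{k′,k″}C^r(T*𝕋ⁿ)/Π_{k′}C^r(T*𝕋ⁿ). So we get that ⋃_{Π_{k′}P ∈ 𝒪_{1,k″}} (𝒪_{1,2}(Π_{k′}P) ×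
𝔅₁(C^r(T*𝕋ⁿ)/Π_{k′,k″}C^r(T*𝕋ⁿ))) is open dense in 𝒪_{1,k″} × 𝔅₁(C^r(T*𝕋ⁿ)/Π_{k′}C^r(T*𝕋ⁿ)). Taking union
over all the k″, we get the statement in the Proposition."  **Theorem [ThmKU]** (l.1402): "[Karatowski-Ulam,
Theorem 15.1 of [Ox]] Let X, Y be two topological spaces where Y has a countable bases. If E ⊂ X × Y is a set
of first category, then E ∩ {x} × Y is first category in Y for all x except a set of first category."  l.1978:
"Similar to Lemma [LmResidualKU], by an application of the Karatowski-Ulam Theorem [ThmKU], we get that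
∪_{Π_K P ∈ 𝒪^{(ℓ)}_κ} 𝒪^{(ℓ+1)}_{κ+1}(Π_K P) intersects the unit ball of C^r(T*𝕋ⁿ) in an open-dense set of the
latter."  Downstream: l.2140 "We take intersection of the open-dense sets obtained in Proposition
[ProNDGInduction] and [PropDoubleell] to get the open-dense set 𝒪."; l.2183 "Denote by 𝒪 ⊂ 𝔅₁ the open-dense
set obtained by taking intersection of the finitely many open-dense sets. We choose a P ∈ 𝒪 such that the
finitely many conditions are satisfied."

THE ABSTRACTION.  The set of the lemma is a FIBRE UNION: a base set `𝒪 ⊆ X` (= 𝒪_{1,k″} ⊆ Π_{k′}C^r, open) and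
for every base point `x` a fibre `F x ⊆ Y` (= 𝒪_{1,2}(Π_{k′}P) ⊆ Y = 𝔅₁(Π_{k′,k″}C^r/Π_{k′}C^r), open and dense
for `x ∈ 𝒪`, depending on `x` with NO STATED REGULARITY — through δ(Π_{k′}P), μ, k″ and the segment ω̄_a), and
`fibreUnion 𝒪 F = {(x, y) | x ∈ 𝒪 ∧ y ∈ F x} ⊆ X × Y` (the text writes ⋃_{Π_{k′}P ∈ 𝒪_{1,k″}} 𝒪_{1,2}(Π_{k′}P)
for this subset of the product space, l.1395).  The inert trailing factor 𝔅₁(C^r/Π_{k′,k″}C^r) and everything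
Hamiltonian are discarded.

WHAT IS PROVED (all kernel-checked; (A)/(KU)/(R)/(C)/(F) is the cell's "census by target format" for AF1‴):
* (A) `dense_fibreUnion` [folklore]: `𝒪` dense and every fibre over `𝒪` dense ⇒ the fibre union is DENSE.  No
  category argument is needed for this much of the lemma's conclusion.
* (KU) `fibreUnion_mem_residual_of_baireMeasurableSet`: `𝒪` residual, the fibres over `𝒪` residual, AND THE
  FIBRE UNION HAS THE PROPERTY OF BAIRE ⇒ the fibre union is RESIDUAL.  This is Oxtoby's Thm 15.4
  (`Literature.Topology.mem_residual_of_baireMeasurableSet_of_sections`), the partial CONVERSE of the theorem the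
  text cites: Thm 15.1 (= [ThmKU], l.1402) goes from a first-category SET to its SECTIONS and says nothing about a
  set given fibrewise; the direction used needs the property of Baire of the union, which cannot be dropped (Oxtoby
  Thm 15.5) and which the text does not address.  `eventually_section_fibreUnion` records what 15.1 itself gives
  here: from "the fibre union is residual" back to "residually many fibres are residual" — the hypothesis, not the
  goal.
* (R) `isOpen_fibreUnion_iff`, `isOpen_dense_fibreUnion_of_isOpen` [folklore]: over an open base the fibre union is
  OPEN iff the fibres are the sections `F x = G_x` of ONE JOINTLY OPEN `G ⊆ X × Y`, and then it is
  `(𝒪 ×ˢ univ) ∩ G`, open and dense when `𝒪` and the fibres are dense.  Joint openness in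
  (Π_{k′}P, Π_{k′,k″}P − Π_{k′}P) — not Kuratowski–Ulam — is what the stated conclusion OPEN-dense requires; the
  text's "since each 𝒪_{1,2}(Π_{k′}P) is open in Π_{k′,k″}C^r/Π_{k′}C^r, … the union … is also open in
  Π_{k′,k″}C^r/Π_{k′}C^r" (l.1396) is openness of the union of the fibres inside the ONE fibre space `Y`, from
  which openness of the fibre union in `X × Y` does not follow — (C).
* (C) `counterexample_fibreUnion` [folklore]: in ℝ × ℝ there is a fibre map with EVERY fibre open and dense
  (complements of finite sets) over the base `univ` whose fibre union is residual and has the property of Baire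
  but has EMPTY INTERIOR — it is not open and contains no non-empty open set, let alone an open dense one (it is
  the complement of the dense countable "staircase" `{(q_n, q_m) | m ≤ n}` over an enumeration `q` of ℚ).  So
  "fibrewise open-dense over an open dense base" does not yield "open-dense", with or without Kuratowski–Ulam;
  what 15.4 yields, granted the property of Baire, is "residual".
* (F) `exists_dense_disjoint`, `exists_not_isMeagre_disjoint`, `dense_biInter_of_mem_residual` [folklore]: the
  proof's own outputs "dense" / "second category" (l.1392, l.1395) are not stable under the finite intersections
  taken downstream (l.2140, l.2183) — two dense, resp. two second-category, subsets of ℝ can be disjoint — whereas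
  finitely (indeed countably) many residual sets intersect in a residual, hence dense, set of a Baire space.
READING (a statement about formats, not about Hamiltonian dynamics; typed, not adjudicated — owner: the cell's
claim row C17).  From the data the proof names (an open dense base, fibrewise open-dense fibres, [ThmKU]) the
lemma's conclusion OPEN-DENSE does not follow (C); Kuratowski–Ulam in the direction actually used (15.4, not the
cited 15.1) gives RESIDUAL, and only granted the property of Baire of the fibre union (KU); RESIDUAL would serve
the final "choose P in the intersection of finitely many such sets" (F) — and (KU) accepts a residual base, so an
induction on residual sets is conceivable — but as written the hypothesis of Prop. [ProNDGInduction] (l.1974: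
"Suppose there exists an open-dense set 𝒪^{(ℓ)}_κ ⊂ Π_{K^{(ℓ)}_κ}C^r(T*𝕋ⁿ) … such that each Π_{K^{(ℓ)}_κ}P(y,·) ∈
𝒪^{(ℓ)}_κ has a unique nondegenerate global max …") consumes the OPEN-dense format at every step of the induction,
and the statements of Lemma [LmResidualKU], of l.1978 and of the main theorem (v5 l.208, "open-dense") say
open-dense; the repair matching them is the joint-openness format (R), i.e. local uniformity in Π_{k′}P of δ, μ,
k″, ω̄_a and of the non-degeneracy — unwritten in v5 (compare the cell's AF1′ on the height ε_P,
`GenericityAssembly.lean`).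
-/

open Set Filter Topology

namespace Literature.Dynamics.Hamiltonian.ChengXue2023

variable {X Y : Type*}

/-- **The fibre-union format** of Cheng–Xue v5 Lemma `LmResidualKU` (l.1388, l.1395: "the union
⋃_{Π_{k′}P ∈ 𝒪_{1,k″}} 𝒪_{1,2}(Π_{k′}P) … in the product space 𝒪_{1,k″} × 𝔅₁(…)") and of l.1978: for a base set
`𝒪 ⊆ X` and a fibre map `F : X → Set Y`, the subset `{(x, y) | x ∈ 𝒪 ∧ y ∈ F x}` of `X × Y`.  Dictionary:
`X = Π_{k′}C^r(T*𝕋ⁿ)`, `Y = 𝔅₁(Π_{k′,k″}C^r/Π_{k′}C^r)`, `𝒪 = 𝒪_{1,k″}`, `F (Π_{k′}P) = 𝒪_{1,2}(Π_{k′}P)`.  An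
abstraction of a claim's bookkeeping (cell DIVERGENCE L19), not a statement of the paper; nothing Hamiltonian is
retained. [cite: ChengXue2023, Lemma LmResidualKU (arXiv v5 l.1388–1401) — format only] -/
def fibreUnion (𝒪 : Set X) (F : X → Set Y) : Set (X × Y) := {p | p.1 ∈ 𝒪 ∧ p.2 ∈ F p.1}

/-- Membership in the fibre union. [folklore] -/
theorem mk_mem_fibreUnion {𝒪 : Set X} {F : X → Set Y} {x : X} {y : Y} :
    (x, y) ∈ fibreUnion 𝒪 F ↔ x ∈ 𝒪 ∧ y ∈ F x := Iff.rfl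

/-- The section of the fibre union over a base point `x ∈ 𝒪` is the fibre `F x`. [folklore] -/
theorem section_fibreUnion_of_mem {𝒪 : Set X} {F : X → Set Y} {x : X} (hx : x ∈ 𝒪) :
    {y | (x, y) ∈ fibreUnion 𝒪 F} = F x := by
  ext y
  simp [fibreUnion, hx]

/-- The section of the fibre union over a point outside the base is empty. [folklore] -/
theorem section_fibreUnion_of_not_mem {𝒪 : Set X} {F : X → Set Y} {x : X} (hx : x ∉ 𝒪) :
    {y | (x, y) ∈ fibreUnion 𝒪 F} = ∅ := by
  ext y
  simp [fibreUnion, hx]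

variable [TopologicalSpace X] [TopologicalSpace Y]

/-- **(A) What holds as written: density.**  If the base `𝒪` is dense in `X` and every fibre over `𝒪` is dense
in `Y`, the fibre union is dense in `X × Y` (every open box `U ×ˢ V` meets it: pick `x ∈ U ∩ 𝒪`, then
`y ∈ V ∩ F x`).  No category theory, no regularity of `F`. [folklore] -/
theorem dense_fibreUnion {𝒪 : Set X} {F : X → Set Y} (h𝒪 : Dense 𝒪) (hF : ∀ x ∈ 𝒪, Dense (F x)) :
    Dense (fibreUnion 𝒪 F) := by
  rw [dense_iff_inter_open]
  rintro W hW ⟨⟨a, b⟩, hab⟩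
  obtain ⟨U, V, hU, hV, haU, hbV, hUV⟩ := isOpen_prod_iff.mp hW a b hab
  obtain ⟨x, hxU, hx𝒪⟩ := h𝒪.inter_open_nonempty U hU ⟨a, haU⟩
  obtain ⟨y, hyV, hyF⟩ := (hF x hx𝒪).inter_open_nonempty V hV ⟨b, hbV⟩
  exact ⟨(x, y), hUV (mk_mem_prod hxU hyV), hx𝒪, hyF⟩

/-- **(KU) What Kuratowski–Ulam gives, and under which hypothesis.**  Let `Y` have a countable base.  If the base
`𝒪` is residual in `X`, every fibre over `𝒪` is residual in `Y`, AND THE FIBRE UNION HAS THE PROPERTY OF BAIRE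
(`BaireMeasurableSet`), then the fibre union is residual in `X × Y`.  This is Oxtoby's Thm 15.4 — the partial
converse of the Thm 15.1 cited at v5 l.1402 — and the property-of-Baire hypothesis cannot be dropped (Oxtoby
Thm 15.5).  No Baire-space hypothesis on `X`, `Y`. [cite: Oxtoby1980, Thm 15.4] -/
theorem fibreUnion_mem_residual_of_baireMeasurableSet [SecondCountableTopology Y] {𝒪 : Set X}
    {F : X → Set Y} (h𝒪 : 𝒪 ∈ residual X) (hF : ∀ x ∈ 𝒪, F x ∈ residual Y)
    (hB : BaireMeasurableSet (fibreUnion 𝒪 F)) : fibreUnion 𝒪 F ∈ residual (X × Y) := by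
  refine Literature.Topology.mem_residual_of_baireMeasurableSet_of_sections hB ?_
  filter_upwards [h𝒪] with x hx
  rw [section_fibreUnion_of_mem hx]
  exact hF x hx

/-- What the CITED theorem (Oxtoby Thm 15.1 = [ThmKU], v5 l.1402) gives for this format: it goes the other way —
IF the fibre union is residual, then for residually many `x` its section (`= F x` over `𝒪`, `= ∅` off `𝒪`) is
residual.  That is the hypothesis of the lemma's situation, not its conclusion. [cite: Oxtoby1980, Thm 15.1] -/
theorem eventually_section_fibreUnion [SecondCountableTopology Y] {𝒪 : Set X} {F : X → Set Y}
    (h : fibreUnion 𝒪 F ∈ residual (X × Y)) :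
    ∀ᵇ x : X, {y | (x, y) ∈ fibreUnion 𝒪 F} ∈ residual Y :=
  Literature.Topology.eventually_residual_section_mem_residual h

/-- **(R) The repair format: joint openness.**  Over an OPEN base `𝒪`, the fibre union is open in `X × Y` if and
only if the fibres over `𝒪` are the sections `F x = {y | (x, y) ∈ G}` of a single OPEN set `G ⊆ X × Y` (take
`G` = the fibre union itself).  Openness of each fibre separately — or of their union inside `Y`, which is what
v5 l.1396 argues — is not enough: `counterexample_fibreUnion`. [folklore] -/
theorem isOpen_fibreUnion_iff {𝒪 : Set X} {F : X → Set Y} (h𝒪 : IsOpen 𝒪) :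
    IsOpen (fibreUnion 𝒪 F) ↔ ∃ G : Set (X × Y), IsOpen G ∧ ∀ x ∈ 𝒪, F x = {y | (x, y) ∈ G} := by
  refine ⟨fun h => ⟨fibreUnion 𝒪 F, h, fun x hx => (section_fibreUnion_of_mem hx).symm⟩,
    fun ⟨G, hG, hFG⟩ => ?_⟩
  have hEq : fibreUnion 𝒪 F = (𝒪 ×ˢ univ) ∩ G := by
    ext ⟨x, y⟩
    simp only [mk_mem_fibreUnion, mem_inter_iff, mem_prod, mem_univ, and_true]
    constructor
    · rintro ⟨hx, hy⟩
      rw [hFG x hx] at hy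
      exact ⟨hx, hy⟩
    · rintro ⟨hx, hxy⟩
      rw [hFG x hx]
      exact ⟨hx, hxy⟩
  rw [hEq]
  exact (h𝒪.prod isOpen_univ).inter hG

/-- **(R), the form matching the lemma's stated conclusion.**  If `𝒪` is open and dense, `G ⊆ X × Y` is OPEN, and
for every `x ∈ 𝒪` the section `G_x` is dense in `Y`, then the fibre union of the sections — which is
`(𝒪 ×ˢ univ) ∩ G` — is open and dense in `X × Y`.  In the application this asks that "unique non-degenerate global
maximum along `ω⁻¹(ω̄_a)` up to finitely many bifurcations" be an open condition JOINTLY in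
(Π_{k′}P, Π_{k′,k″}P − Π_{k′}P), i.e. that δ, μ, k″, ω̄_a be locally uniform in Π_{k′}P — unwritten in v5.
[folklore] -/
theorem isOpen_dense_fibreUnion_of_isOpen {𝒪 : Set X} {G : Set (X × Y)} (h𝒪 : IsOpen 𝒪) (h𝒪d : Dense 𝒪)
    (hG : IsOpen G) (hGd : ∀ x ∈ 𝒪, Dense {y | (x, y) ∈ G}) :
    IsOpen (fibreUnion 𝒪 fun x => {y | (x, y) ∈ G}) ∧ Dense (fibreUnion 𝒪 fun x => {y | (x, y) ∈ G}) :=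
  ⟨(isOpen_fibreUnion_iff h𝒪).mpr ⟨G, hG, fun _ _ => rfl⟩, dense_fibreUnion h𝒪d hGd⟩

/-! ### (C) The counterexample: fibrewise open-dense, union residual with empty interior -/

/-- An enumeration of ℚ inside ℝ (injective, dense range): `n ↦ (Denumerable.ofNat ℚ n : ℝ)`. [folklore] -/
def ratSeq (n : ℕ) : ℝ := ((Denumerable.ofNat ℚ n : ℚ) : ℝ)

/-- `ratSeq` is injective. [folklore] -/
theorem ratSeq_injective : Function.Injective ratSeq := fun m n h =>
  (Denumerable.eqv ℚ).symm.injective (Rat.cast_injective h : Denumerable.ofNat ℚ m = Denumerable.ofNat ℚ n)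

/-- `ratSeq` has dense range (its range is the range of `ℚ → ℝ`). [folklore] -/
theorem dense_range_ratSeq : Dense (range ratSeq) := by
  refine Rat.denseRange_cast.mono ?_
  rintro _ ⟨q, rfl⟩
  exact ⟨Denumerable.eqv ℚ q, congrArg (fun r : ℚ => (r : ℝ)) ((Denumerable.eqv ℚ).symm_apply_apply q)⟩

/-- The "staircase": the countable set `{(ratSeq n, ratSeq m) | m ≤ n} ⊆ ℝ × ℝ`.  Its vertical sections are
finite, yet it is dense in the plane. [folklore] -/
def staircase : Set (ℝ × ℝ) := {p | ∃ m n : ℕ, m ≤ n ∧ p = (ratSeq n, ratSeq m)}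

/-- The fibres of the counterexample: `x ↦` the complement of the (finite) section of the staircase over `x`.
[folklore] -/
def staircaseFibre (x : ℝ) : Set ℝ := {y | (x, y) ∉ staircase}

/-- Every vertical section of the staircase is finite (over `ratSeq n₀` it is `{ratSeq m | m ≤ n₀}`, over any
other point it is empty). [folklore] -/
theorem finite_section_staircase (x : ℝ) : {y | (x, y) ∈ staircase}.Finite := by
  by_cases hx : ∃ n₀, ratSeq n₀ = x
  · obtain ⟨n₀, rfl⟩ := hx
    refine ((finite_Iic n₀).image ratSeq).subset ?_
    rintro y ⟨m, n, hmn, h⟩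
    rw [Prod.mk.injEq] at h
    obtain ⟨hn, rfl⟩ := h
    exact ⟨m, hmn.trans (ratSeq_injective hn.symm).le, rfl⟩
  · refine finite_empty.subset ?_
    rintro y ⟨m, n, -, h⟩
    rw [Prod.mk.injEq] at h
    exact (hx ⟨n, h.1.symm⟩).elim

/-- The staircase is dense in ℝ × ℝ: an open box `U ×ˢ V` contains `(ratSeq n, ratSeq m)` with `ratSeq m ∈ V`
and `n ≥ m`, `ratSeq n ∈ U` (the range of `ratSeq` minus finitely many points is still dense). [folklore] -/
theorem dense_staircase : Dense staircase := by
  rw [dense_iff_inter_open]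
  rintro W hW ⟨⟨a, b⟩, hab⟩
  obtain ⟨U, V, hU, hV, haU, hbV, hUV⟩ := isOpen_prod_iff.mp hW a b hab
  obtain ⟨_, hyV, ⟨m, rfl⟩⟩ := dense_range_ratSeq.inter_open_nonempty V hV ⟨b, hbV⟩
  have hD : Dense (range ratSeq \ ratSeq '' Iio m) :=
    dense_range_ratSeq.sdiff_finite ((finite_Iio m).image ratSeq)
  obtain ⟨_, hxU, ⟨n, rfl⟩, hxn⟩ := hD.inter_open_nonempty U hU ⟨a, haU⟩
  have hmn : m ≤ n := by
    by_contra hlt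
    exact hxn (mem_image_of_mem ratSeq (show n ∈ Iio m from not_le.mp hlt))
  exact ⟨(ratSeq n, ratSeq m), hUV (mk_mem_prod hxU hyV), m, n, hmn, rfl⟩

/-- The staircase is meagre in ℝ × ℝ (it lies in `range ratSeq ×ˢ univ`, and a countable subset of ℝ is meagre;
Oxtoby Thm 15.3, easy direction). [folklore] -/
theorem isMeagre_staircase : IsMeagre staircase := by
  have hR : IsMeagre (range ratSeq) := by
    rw [← iUnion_singleton_eq_range]
    exact isMeagre_iUnion fun n =>
      (isClosed_singleton.isNowhereDense_iff.mpr (interior_singleton (ratSeq n))).isMeagre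
  refine (Literature.Topology.isMeagre_prod_of_left hR (univ : Set ℝ)).mono ?_
  rintro _ ⟨m, n, -, rfl⟩
  exact mk_mem_prod (mem_range_self n) (mem_univ _)

/-- The fibre union of the counterexample over the base `univ` is the complement of the staircase. [folklore] -/
theorem fibreUnion_staircaseFibre : fibreUnion univ staircaseFibre = staircaseᶜ := by
  ext ⟨x, y⟩
  simp [fibreUnion, staircaseFibre]

/-- **(C) The counterexample.**  A fibre map on ℝ with EVERY fibre open and dense in ℝ whose fibre union over the
(open, dense) base `univ` is residual and has the property of Baire in ℝ × ℝ, but has EMPTY INTERIOR: it is not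
open, and no non-empty open set — in particular no open dense set — is contained in it.  Hence "for every `Q` in
an open dense set, an open dense set of `y`" does not make the union open-dense (v5 l.1388, l.1396, l.1978), while
Kuratowski–Ulam (15.4) upgrades it, under the property of Baire, exactly to "residual". [folklore] -/
theorem counterexample_fibreUnion :
    ∃ F : ℝ → Set ℝ, (∀ x, IsOpen (F x) ∧ Dense (F x)) ∧
      fibreUnion univ F ∈ residual (ℝ × ℝ) ∧ BaireMeasurableSet (fibreUnion univ F) ∧
      interior (fibreUnion univ F) = ∅ ∧ ¬ IsOpen (fibreUnion univ F) ∧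
      ∀ U : Set (ℝ × ℝ), IsOpen U → U.Nonempty → ¬ U ⊆ fibreUnion univ F := by
  have hres : fibreUnion univ staircaseFibre ∈ residual (ℝ × ℝ) := by
    rw [fibreUnion_staircaseFibre]
    exact isMeagre_staircase
  have hint : interior (fibreUnion univ staircaseFibre) = ∅ := by
    rw [fibreUnion_staircaseFibre, interior_eq_empty_iff_dense_compl, compl_compl]
    exact dense_staircase
  have hno : ∀ U : Set (ℝ × ℝ), IsOpen U → U.Nonempty → ¬ U ⊆ fibreUnion univ staircaseFibre := by
    intro U hU hUne hsub
    have h := interior_maximal hsub hU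
    rw [hint] at h
    exact hUne.ne_empty (subset_empty_iff.mp h)
  refine ⟨staircaseFibre, fun x => ⟨?_, ?_⟩, hres, BaireMeasurableSet.of_mem_residual hres, hint, ?_, hno⟩
  · exact (finite_section_staircase x).isClosed.isOpen_compl
  · have h := dense_univ.sdiff_finite (finite_section_staircase x)
    rw [← compl_eq_univ_sdiff] at h
    exact h
  · intro hopen
    have hne : (fibreUnion univ staircaseFibre).Nonempty := (dense_of_mem_residual hres).nonempty
    exact hno _ hopen hne subset_rfl

/-! ### (F) Which outputs survive the finite intersections taken downstream (l.2140, l.2183) -/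

/-- Two DENSE subsets of ℝ can be disjoint (ℚ and the irrationals): "dense" is not an intersectable genericity
format. [folklore] -/
theorem exists_dense_disjoint : ∃ A B : Set ℝ, Dense A ∧ Dense B ∧ Disjoint A B :=
  ⟨range ((↑) : ℚ → ℝ), {x | Irrational x}, Rat.denseRange_cast, dense_irrational,
    disjoint_left.mpr fun _ hx hx' => hx' hx⟩

/-- Two SECOND-CATEGORY (non-meagre) subsets of ℝ can be disjoint (two disjoint open half-lines): "second
category" (v5 l.1392, l.1395) is not an intersectable genericity format either. [folklore] -/
theorem exists_not_isMeagre_disjoint : ∃ A B : Set ℝ, ¬ IsMeagre A ∧ ¬ IsMeagre B ∧ Disjoint A B :=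
  ⟨Iio 0, Ioi 0, not_isMeagre_of_isOpen isOpen_Iio ⟨-1, by norm_num⟩,
    not_isMeagre_of_isOpen isOpen_Ioi ⟨1, by norm_num⟩,
    disjoint_left.mpr fun _ hx hx' => lt_asymm (mem_Iio.mp hx) (mem_Ioi.mp hx')⟩

/-- Finitely many RESIDUAL subsets of a Baire space intersect in a residual, hence dense (in particular
non-empty, if the space is), set — the format that serves "choose P satisfying the finitely many conditions"
(l.2183); open dense sets are a special case (`residual_of_dense_open`). [folklore] -/
theorem dense_biInter_of_mem_residual {Z : Type*} [TopologicalSpace Z] [BaireSpace Z] {ι : Type*}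
    (s : Finset ι) (A : ι → Set Z) (hA : ∀ i ∈ s, A i ∈ residual Z) : Dense (⋂ i ∈ s, A i) :=
  dense_of_mem_residual ((Filter.biInter_finset_mem s).mpr hA)

end Literature.Dynamics.Hamiltonian.ChengXue2023
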